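import Summits.QuantumFields.YangMills.Theses.BalabanFluctuationExport
import Literature.MathematicalPhysics.QuantumFieldTheory.Balaban1983to89.B10Eq39CollarVolume
import Literature.MathematicalPhysics.QuantumFieldTheory.Balaban1983to89.B3Taylor310LocalRemainder
import HarnessLib

/-!
# `SmallFieldsTypical` from single-plaquette rarity of the averaged field (line `rarity_union_bound`, crux `UVSeamRec`, stmt-QuantumFields-20043)

The glue of LINE 8 (`Lines/rarity_union_bound.lean`, ideator ym-idea-9) landed under `Theorems/` together with its three reusable lemmas
(so far inlined in every skeleton and in three Theorems files):

* `measurable_blockField` — the `k`-fold Bałaban block average `Q_k V = Averaging.iter (blockAvg su2Mean) k (ofConfig V)` is measurable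
  (`BlockAveraging.measurable_avgFun` iterated; `ofConfig` is a coordinate map);
* `measurableSet_plaqSmallOn` — every `δ`-small event `{W | PlaqSmallOn S δ W}` of level-`k` block fields is measurable;
* `card_plaqNear_le` — at most `10⁴` level-`k` plaquettes have their source within coarse `ℓ¹`-distance `2` of a given coarse site
  (`B10Eq39CollarVolume.card_ball_le`);
* `smallFieldsTypical_of_averagedPlaquetteRarity` — the route item `SmallFieldsTypical` (stmt-QuantumFields-26654) follows from the line statement
  `AveragedPlaquetteRarity` (written out as the hypothesis: for every `δ ∈ (0,1]`, `ε > 0` a threshold `β₄` and window `ℓ₄` beyond which every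
  level-`k` plaquette of `Q_k V` is `δ`-rough with Wilson probability `≤ ε`), by the union bound over the `≤ 10⁴` plaquettes near the insertion block
  with `ε = 1/20000`.

With `averagedPlaquetteRarity_fixedDepth` (module `…AveragedPlaquetteRarityFixedDepth`) the hypothesis holds at every FIXED depth; uniformly over the
window it is the unprinted AF / large-field-rarity input (critic VERDICT #19 (3)) and is NOT proved here.  Bookkeeping only; YM mass gap NOT proved.
-/

set_option autoImplicit false

namespace Summit.QuantumFields.YangMills.Cruxes.UVSeamRec.RarityUnionBound

open MeasureTheory
open Literature.MathematicalPhysics.QuantumFieldTheory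
open Literature.MathematicalPhysics.QuantumFieldTheory.Balaban1983to89
open Literature.MathematicalPhysics.QuantumFieldTheory.Balaban1983to89.T4Continuum
open Literature.MathematicalPhysics.QuantumLattice (LGConfig torusLift fundamentalLatticeRep)
open Summit.QuantumFields.YangMills.Cruxes.OSLegsFromFemtoAndGap.DlrCollarTransfer (plane)
open Summit.QuantumFields.YangMills.Cruxes.UV.TorusClass (torusEOn)
open Literature.MathematicalPhysics.QuantumFieldTheory.Balaban1983to89.B10Eq39CollarVolume (ball mem_ball card_ball_le)
open Literature.MathematicalPhysics.QuantumFieldTheory.Balaban1983to89.B3Taylor310LocalRemainder (tdist_comm)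
open Summit.QuantumFields.YangMills.Theses.BalabanFluctuationExport

/-- **Counting**: at most `10⁴` level-`k` plaquettes have their source within coarse `ℓ¹`-distance `2` of a given coarse site
(injection `pl ↦ (src, μ, ν)` into `ball c 2 × Fin 4 × Fin 4`, `card_ball_le`: `≤ 5⁴` sites). -/
theorem card_plaqNear_le (F : T4Family) (K k : ℕ) (c : Site (F.P K) k) :
    (Finset.univ.filter (fun pl : Plaq (F.P K) k => Site.tdist pl.src c ≤ 2)).card ≤ 10000 := by
  classical
  let g : Plaq (F.P K) k → Site (F.P K) k × (Fin (F.P K).d × Fin (F.P K).d) := fun pl => (pl.src, (pl.μ, pl.ν))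
  have hmaps : ∀ pl ∈ Finset.univ.filter (fun pl : Plaq (F.P K) k => Site.tdist pl.src c ≤ 2),
      g pl ∈ (ball c 2) ×ˢ ((Finset.univ : Finset (Fin (F.P K).d)) ×ˢ (Finset.univ : Finset (Fin (F.P K).d))) := by
    intro pl hpl
    rw [Finset.mem_filter] at hpl
    refine Finset.mem_product.mpr ⟨?_, Finset.mem_product.mpr ⟨Finset.mem_univ _, Finset.mem_univ _⟩⟩
    rw [mem_ball, tdist_comm]
    exact hpl.2
  have hinj : Set.InjOn g (Finset.univ.filter (fun pl : Plaq (F.P K) k => Site.tdist pl.src c ≤ 2) : Set (Plaq (F.P K) k)) := by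
    intro p _ p' _ h
    obtain ⟨s, μ, ν, hμν⟩ := p
    obtain ⟨s', μ', ν', hμν'⟩ := p'
    simp only [g, Prod.mk.injEq] at h
    obtain ⟨h1, h2, h3⟩ := h
    subst h1; subst h2; subst h3
    rfl
  have hball : (ball c 2).card ≤ 625 := by
    have := card_ball_le c 2
    simpa [T4Family.P_d] using this
  calc (Finset.univ.filter (fun pl : Plaq (F.P K) k => Site.tdist pl.src c ≤ 2)).card
      ≤ ((ball c 2) ×ˢ ((Finset.univ : Finset (Fin (F.P K).d)) ×ˢ (Finset.univ : Finset (Fin (F.P K).d)))).card :=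
        Finset.card_le_card_of_injOn g hmaps hinj
    _ = (ball c 2).card * 16 := by
        rw [Finset.card_product, Finset.card_product, Finset.card_univ, Fintype.card_fin, T4Family.P_d]
    _ ≤ 10000 := by omega

/-- **The `k`-fold Bałaban block average with the quaternionic projected mean is measurable** (as a map of the fine torus configuration). -/
theorem measurable_blockField (F : T4Family) (K k : ℕ) :
    letI : MeasurableSpace (Matrix.specialUnitaryGroup (Fin 2) ℂ) := borel _
    Measurable (fun V : GaugeConfig 4 ((F.P K).sitesPerDir 0) (Matrix.specialUnitaryGroup (Fin 2) ℂ) =>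
      Averaging.iter (fun j => BlockAveraging.blockAvg (P := F.P K) (j := j) su2Mean) k (ofConfig (P := F.P K) (j := 0) V)) := by
  letI : MeasurableSpace (Matrix.specialUnitaryGroup (Fin 2) ℂ) := borel _
  haveI : BorelSpace (Matrix.specialUnitaryGroup (Fin 2) ℂ) := ⟨rfl⟩
  have hav : ∀ j, Measurable (fun U : GaugeField (F.P K) j (Matrix.specialUnitaryGroup (Fin 2) ℂ) =>
      (BlockAveraging.blockAvg (P := F.P K) (j := j) su2Mean).avg U) :=
    fun j => BlockAveraging.measurable_avgFun (P := F.P K) (j := j) su2Mean measurable_su2Mean_E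
  have hiter : ∀ k', Measurable (Averaging.iter (P := F.P K) (G := Matrix.specialUnitaryGroup (Fin 2) ℂ)
      (fun j => BlockAveraging.blockAvg (P := F.P K) (j := j) su2Mean) k') := by
    intro k'
    induction k' with
    | zero => exact measurable_id
    | succ k' ih => exact (hav k').comp ih
  have hof : Measurable (fun V : GaugeConfig 4 ((F.P K).sitesPerDir 0) (Matrix.specialUnitaryGroup (Fin 2) ℂ) =>
      ofConfig (P := F.P K) (j := 0) V) :=
    measurable_pi_lambda _ fun b => measurable_pi_apply _
  exact (hiter k).comp hof
/-- **Every `δ`-small event of level-`k` block fields is measurable** (finite intersection of open sublevel sets of the continuous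
`W ↦ dist1 (∂W(pl))`). -/
theorem measurableSet_plaqSmallOn (F : T4Family) (K k : ℕ) (S : Set (Plaq (F.P K) k)) (δ : ℝ) :
    letI : MeasurableSpace (Matrix.specialUnitaryGroup (Fin 2) ℂ) := borel _
    MeasurableSet {W : GaugeField (F.P K) k (Matrix.specialUnitaryGroup (Fin 2) ℂ) | PlaqSmallOn S δ W} := by
  letI : MeasurableSpace (Matrix.specialUnitaryGroup (Fin 2) ℂ) := borel _
  haveI : BorelSpace (Matrix.specialUnitaryGroup (Fin 2) ℂ) := ⟨rfl⟩
  have hpl : ∀ pl : Plaq (F.P K) k, Measurable (fun W : GaugeField (F.P K) k (Matrix.specialUnitaryGroup (Fin 2) ℂ) =>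
      dist1 (GaugeField.plaqHol W pl)) := fun pl => by
    have hb : ∀ b : PBond (F.P K) k, Continuous fun U : (PBond (F.P K) k → Matrix.specialUnitaryGroup (Fin 2) ℂ) => U b :=
      fun b => continuous_apply b
    have hc : Continuous fun U : (PBond (F.P K) k → Matrix.specialUnitaryGroup (Fin 2) ℂ) =>
        GaugeField.plaqHol (P := F.P K) (j := k) U pl := by
      unfold GaugeField.plaqHol
      exact (((hb _).mul (hb _)).mul (hb _).inv).mul (hb _).inv
    have hm : Measurable fun U : (PBond (F.P K) k → Matrix.specialUnitaryGroup (Fin 2) ℂ) =>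
        dist1 (GaugeField.plaqHol (P := F.P K) (j := k) U pl) :=
      RegularGaugeGroup.measurable_dist1.comp hc.measurable
    exact hm
  have : {W : GaugeField (F.P K) k (Matrix.specialUnitaryGroup (Fin 2) ℂ) | PlaqSmallOn S δ W}
      = ⋂ pl ∈ S, {W | dist1 (GaugeField.plaqHol W pl) < δ} := by
    ext W; simp only [PlaqSmallOn, Set.mem_setOf_eq, Set.mem_iInter]
  rw [this]
  exact MeasurableSet.biInter (Set.to_countable _) fun pl _ => measurableSet_lt (hpl pl) measurable_const

/-- **The glue, proved against the `let`-expanded forms** (hypothesis = the line statement `AveragedPlaquetteRarity` written out; conclusion =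
`SmallFieldsTypical` with its `let`s expanded, definitionally the route decl): rarity at `ε = 1/20000` and the union bound over the `≤ 10⁴`
plaquettes near the insertion block give probability `≥ 1/2` of the `δ`-small event. -/
theorem smallFieldsTypical_of_averagedPlaquetteRarity_expanded :
    letI : MeasurableSpace (Matrix.specialUnitaryGroup (Fin 2) ℂ) := borel _
    haveI : BorelSpace (Matrix.specialUnitaryGroup (Fin 2) ℂ) := ⟨rfl⟩
    (∀ L : ℕ, Odd L → 11 < L → ∀ δ : ℝ, 0 < δ → δ ≤ 1 → ∀ ε : ℝ, 0 < ε →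
      ∃ (β₄ ℓ₄ : ℝ), 0 < ℓ₄ ∧ ∀ β : ℝ, β₄ ≤ β →
        ∀ (F : T4Family) (K k : ℕ), F.L = L → k + 1 ≤ F.m + K →
          ((L : ℝ) ^ k) * Summit.QuantumFields.YangMills.Cruxes.UVSeamRec.Transport.uRec β ≤ ℓ₄ →
          haveI : NeZero ((F.P K).sitesPerDir 0) := ⟨Params.sitesPerDir_ne_zero _ _⟩
          let Q : GaugeConfig 4 ((F.P K).sitesPerDir 0) (Matrix.specialUnitaryGroup (Fin 2) ℂ) →
              GaugeField (F.P K) k (Matrix.specialUnitaryGroup (Fin 2) ℂ) :=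
            fun V => Averaging.iter (fun j => BlockAveraging.blockAvg (P := F.P K) (j := j) su2Mean) k (ofConfig (P := F.P K) (j := 0) V)
          let μ := wilsonMeasure (d := 4) (L := (F.P K).sitesPerDir 0) (fundamentalLatticeRep 2).ρ β
          ∀ pl : Plaq (F.P K) k, (μ {V | δ ≤ dist1 (GaugeField.plaqHol (Q V) pl)}).toReal ≤ ε) →
      ∀ L : ℕ, Odd L → 11 < L → ∀ δ : ℝ, 0 < δ → δ ≤ 1 →
      ∃ (β₄ ℓ₄ : ℝ), 0 < ℓ₄ ∧ ∀ β : ℝ, β₄ ≤ β →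
        ∀ (F : T4Family) (K k : ℕ), F.L = L → k + 1 ≤ F.m + K →
          ((L : ℝ) ^ k) * Summit.QuantumFields.YangMills.Cruxes.UVSeamRec.Transport.uRec β ≤ ℓ₄ →
          haveI : NeZero ((F.P K).sitesPerDir 0) := ⟨Params.sitesPerDir_ne_zero _ _⟩
          ∀ x : Fin 4 → ℤ,
            (1 / 2 : ℝ) ≤ ((wilsonMeasure (d := 4) (L := (F.P K).sitesPerDir 0) (fundamentalLatticeRep 2).ρ β)
              {V | PlaqSmallOn {pl : Plaq (F.P K) k | Site.tdist pl.src
                  (fun ν => (((((x ν : ℤ) : ZMod ((F.P K).sitesPerDir 0))).val / F.L ^ k : ℕ) : ZMod ((F.P K).sitesPerDir k))) ≤ 2} δ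
                (Averaging.iter (fun j => BlockAveraging.blockAvg (P := F.P K) (j := j) su2Mean) k (ofConfig (P := F.P K) (j := 0) V))}).toReal := by
  classical
  intro hR
  letI : MeasurableSpace (Matrix.specialUnitaryGroup (Fin 2) ℂ) := borel _
  haveI : BorelSpace (Matrix.specialUnitaryGroup (Fin 2) ℂ) := ⟨rfl⟩
  intro L hLo hL11 δ hδ0 hδ1
  obtain ⟨β₄, ℓ₄, hℓ₄, hRare⟩ := hR L hLo hL11 δ hδ0 hδ1 (1 / 20000) (by norm_num)
  refine ⟨β₄, ℓ₄, hℓ₄, ?_⟩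
  intro β hβ F K k hFL hk hb x
  haveI : NeZero ((F.P K).sitesPerDir 0) := ⟨Params.sitesPerDir_ne_zero _ _⟩
  set M : ℕ := (F.P K).sitesPerDir 0 with hMdef
  set Q : GaugeConfig 4 M (Matrix.specialUnitaryGroup (Fin 2) ℂ) →
      GaugeField (F.P K) k (Matrix.specialUnitaryGroup (Fin 2) ℂ) :=
    fun V => Averaging.iter (fun j => BlockAveraging.blockAvg (P := F.P K) (j := j) su2Mean) k
      (ofConfig (P := F.P K) (j := 0) V) with hQdef
  set μ : Measure (GaugeConfig 4 M (Matrix.specialUnitaryGroup (Fin 2) ℂ)) :=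
    wilsonMeasure (d := 4) (L := M) (fundamentalLatticeRep 2).ρ β with hμdef
  let c : Site (F.P K) k :=
    fun ν => (((((x ν : ℤ) : ZMod ((F.P K).sitesPerDir 0))).val / F.L ^ k : ℕ) : ZMod ((F.P K).sitesPerDir k))
  let N : Set (Plaq (F.P K) k) := {pl | Site.tdist pl.src c ≤ 2}
  let T : Finset (Plaq (F.P K) k) := Finset.univ.filter fun pl => Site.tdist pl.src c ≤ 2
  let E : Set (GaugeConfig 4 M (Matrix.specialUnitaryGroup (Fin 2) ℂ)) := {V | PlaqSmallOn N δ (Q V)}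
  let R : Plaq (F.P K) k → Set (GaugeConfig 4 M (Matrix.specialUnitaryGroup (Fin 2) ℂ)) :=
    fun pl => {V | δ ≤ dist1 (GaugeField.plaqHol (Q V) pl)}
  haveI : IsProbabilityMeasure μ :=
    isProbabilityMeasure_wilsonMeasure (d := 4) (L := M) (fundamentalLatticeRep 2).ρ (fundamentalLatticeRep 2).continuous β
  have hQm : Measurable Q := measurable_blockField F K k
  have hE : MeasurableSet E := hQm (measurableSet_plaqSmallOn F K k N δ)
  -- the complement of the small-field event is covered by the rough-plaquette events near the block
  have hcover : Eᶜ ⊆ ⋃ pl ∈ T, R pl := by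
    intro V hV
    have hV' : ¬ PlaqSmallOn N δ (Q V) := hV
    simp only [PlaqSmallOn, not_forall, not_lt, exists_prop] at hV'
    obtain ⟨pl, hpl, hge⟩ := hV'
    simp only [Set.mem_iUnion, exists_prop]
    exact ⟨pl, Finset.mem_filter.mpr ⟨Finset.mem_univ _, hpl⟩, hge⟩
  have hper : ∀ pl ∈ T, μ.real (R pl) ≤ 1 / 20000 := fun pl _ => hRare β hβ F K k hFL hk hb pl
  have hT : T.card ≤ 10000 := card_plaqNear_le F K k c
  have hUnion : μ.real (Eᶜ) ≤ 1 / 2 :=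
    calc μ.real (Eᶜ) ≤ μ.real (⋃ pl ∈ T, R pl) := measureReal_mono hcover (measure_ne_top μ _)
      _ ≤ ∑ pl ∈ T, μ.real (R pl) := measureReal_biUnion_finset_le T R
      _ ≤ ∑ _pl ∈ T, (1 / 20000 : ℝ) := Finset.sum_le_sum hper
      _ = T.card * (1 / 20000 : ℝ) := by simp
      _ ≤ 10000 * (1 / 20000 : ℝ) := by gcongr; exact_mod_cast hT
      _ = 1 / 2 := by norm_num
  have hcompl : μ.real (Eᶜ) = 1 - μ.real E := probReal_compl_eq_one_sub hE
  show (1 / 2 : ℝ) ≤ μ.real E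
  linarith


/-- **Route item `SmallFieldsTypical` (stmt-QuantumFields-26654) FROM `AveragedPlaquetteRarity`** (the LINE 8 statement, written out as the
hypothesis; this is the previous theorem read on the route decl). -/
theorem smallFieldsTypical_of_averagedPlaquetteRarity
    (hR : letI : MeasurableSpace (Matrix.specialUnitaryGroup (Fin 2) ℂ) := borel _
      haveI : BorelSpace (Matrix.specialUnitaryGroup (Fin 2) ℂ) := ⟨rfl⟩
        ∀ L : ℕ, Odd L → 11 < L → ∀ δ : ℝ, 0 < δ → δ ≤ 1 → ∀ ε : ℝ, 0 < ε →
        ∃ (β₄ ℓ₄ : ℝ), 0 < ℓ₄ ∧ ∀ β : ℝ, β₄ ≤ β →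
          ∀ (F : T4Family) (K k : ℕ), F.L = L → k + 1 ≤ F.m + K →
            ((L : ℝ) ^ k) * Summit.QuantumFields.YangMills.Cruxes.UVSeamRec.Transport.uRec β ≤ ℓ₄ →
            haveI : NeZero ((F.P K).sitesPerDir 0) := ⟨Params.sitesPerDir_ne_zero _ _⟩
            let Q : GaugeConfig 4 ((F.P K).sitesPerDir 0) (Matrix.specialUnitaryGroup (Fin 2) ℂ) →
                GaugeField (F.P K) k (Matrix.specialUnitaryGroup (Fin 2) ℂ) :=
              fun V => Averaging.iter (fun j => BlockAveraging.blockAvg (P := F.P K) (j := j) su2Mean) k (ofConfig (P := F.P K) (j := 0) V)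
            let μ := wilsonMeasure (d := 4) (L := (F.P K).sitesPerDir 0) (fundamentalLatticeRep 2).ρ β
            ∀ pl : Plaq (F.P K) k, (μ {V | δ ≤ dist1 (GaugeField.plaqHol (Q V) pl)}).toReal ≤ ε) :
    SmallFieldsTypical :=
  smallFieldsTypical_of_averagedPlaquetteRarity_expanded hR

end Summit.QuantumFields.YangMills.Cruxes.UVSeamRec.RarityUnionBound
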